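import Summits.QuantumFields.YangMills.Theorems.BlockPlaquetteOneStepLinearisation
import Summits.QuantumFields.YangMills.Theorems.UnitScaleGibbsBlockPlaquetteStokesLinearisation
import HarnessLib

/-!
# The one-step block plaquette linearised ALL THE WAY DOWN to the fine plaquette variables, and the substitution step of the `j`-fold induction
# ((M3-ENGINE) = the knit (M1) ⊕ (b′) of the S_lin stub of the crux idea «gross-sd-transfer», LINE 28 candidate on `UnitScaleTilt.HistoryTailL`, stmt-QuantumFields-19936;
# `Cruxes/HistoryTailL/Ideas/gross-sd-transfer.md`, `GrossTransferAnnex1.md` §2 (iv); ideator ym-r3-idea-2 g15 16:31:51Z: «(M3) … unassigned until (M1)+(b′) land»)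

T. Bałaban, *Averaging operations for lattice gauge theories*, Commun. Math. Phys. **98** (1985) 17–51 [Balaban1985Averaging], Prop. 3 (124) p. 36: *«The first term on
the right-hand side above is the main term in this linear form … The remaining terms are small»*, with (9) p. 18, (19) p. 21; T. Bałaban, *Renormalization group
approach to lattice gauge field theories. I*, Commun. Math. Phys. **109** (1987) 249–301 [Balaban1987RG1], (0.3)–(0.4) pp. 252–253 (the symmetric block averaging with the
printed `exp[mean log]`, the averaging OF RECORD `ℰp`).

THE TWO LANDED HALVES, BY NAME.  (M1) ✓ `BlockPlaquetteOneStepLinearisation.norm_plaqHol_avgFun_sub_one_sub_offsetMean_le` (★w2-19936 g14): the coarse plaquette variable of the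
(0.4)+`exp[mean log]` average is, to second order (`143·s²`, `s = ((d+4)L)²a∕4`), the offset-mean over the (0.4) index `J = (r, σ, τ, ρ, ω)` of the TRANSPORTED TRANSLATED
`L × L` squares `T_J·rect U x_J μ ν L L·T_J⁻¹ − 1`, `x_J = walkEnd (emb y) (stairWord σ (off r))`, `T_J = holAt U (walk (emb y) (stairWord σ (off r)))`.  (b′)
✓ `UnitScaleGibbsBlockPlaquetteStokesLinearisation.norm_rect_sub_one_sub_sum_conj_plaq_le` (this seat): each square is, to second order (`(1+a)^{L²} − 1 − L²a ≤ (L²a)²`),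
the transported sum of its `L²` fine plaquette variables, `T_{s,t}·(U(∂p_{s,t}) − 1)·T_{s,t}*`.

WHAT THIS FILE PROVES (kernel; 0 `def`, 0 `sorry`; `SU(N)`, any `Params`, any level `j`; hypotheses = (M1)'s: `∀ q, dist₁(U(∂q)) ≤ a`, `((d+4)L)²a∕4 ≤ δ_N∕2`):
* §0 one letter ★ `norm_coe_conj_sub_one_sub_conj_le`: `‖(g Q g⁻¹ − 1) − g Z g*‖ ≤ ‖(Q − 1) − Z‖` (conjugation commutes with «subtract `1` and a linear proxy» and does
  not increase the operator norm; from ✓ `Prop7HolRatioPerStep.norm_coe_eq_one` ∕ `coe_mul_star_self`).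
* §1 ★★★ `norm_plaqHol_avgFun_sub_one_sub_fullLin_le` (K): `‖Ū(∂p′) − 1 − |J|⁻¹ Σ_J Σ_{t<L} Σ_{s<L} (T_J T^{J}_{s,t})·(U(∂p^{J}_{s,t}) − 1)·(T_J T^{J}_{s,t})*‖ ≤ 143·s² + (L²a)²`
  — ONE averaging step linearised down to the fine PLAQUETTE variables, with explicit weights `|J|⁻¹` and explicit unitary transports (print's «main term» for (0.4)).
* §2 ★★★ `norm_plaqHol_avgFun_sub_one_sub_fullLin_proxy_le` (S) — THE SUBSTITUTION STEP of the `j`-fold induction: if every fine plaquette deviation carries an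
  arbitrary first-order proxy, `U(∂q) − 1 = A q + R q` with `‖R q‖ ≤ ρ`, then `‖Ū(∂p′) − 1 − |J|⁻¹ Σ_J Σ_{s,t} Ad(T_J T_{s,t})(A p_{s,t})‖ ≤ 143·s² + (L²a)² + L²·ρ` — the
  remainder born below is carried up with the factor `L²` per level (the `ℓ^∞ → ℓ^∞` norm of the one-step map; the source of S_lin's own window `3j < K` in the
  ideator's ∕ ★w2's arithmetic of 2026-08-29).  The `j`-fold statement is `j` instantiations of (S) with the consumer's index bookkeeping (D2's letters).

HONEST SCOPE.  Lattice kinematics of ONE configuration and ONE averaging step (no measure, no expectation, no `j`-fold statement); a brick of the stub S_lin of an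
UNREGISTERED crux idea, typed at own risk pending the ideator's word; proves no stub, nothing of «ShallowFluxSecondMomentL» ∕ (Q) ∕ `MeanDeviationL` ∕ K1 ∕ `HistoryTailL`;
rung R3 (YM₃ on T³) is NOT d = 4, NOT infinite volume, NOT a mass gap, NOT Clay; the Yang–Mills mass gap is NOT proved.  Width seat ym3-torus-px10 g7;
`--supports stmt-QuantumFields-19936 --as helper`.
-/

set_option autoImplicit false

open scoped BigOperators

namespace Summit.QuantumFields.YangMills.Theorems.UnitScaleGibbsBlockPlaquetteOneStepFullLinearisation

open Literature.MathematicalPhysics.QuantumFieldTheory.Balaban1983to89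
open Literature.MathematicalPhysics.QuantumFieldTheory.Balaban1983to89.B10Eq47AxialChi (shiftN rowProd rect)
open Literature.MathematicalPhysics.QuantumFieldTheory.Balaban1983to89.BlockAveraging (avgFun off)
open Literature.MathematicalPhysics.QuantumFieldTheory.Balaban1983to89.ExpMeanLog (expMeanLogSU deltaSU)
open T4Continuum (holAt walk walkEnd stairWord)
open Summit.QuantumFields.YangMills.Theorems.Prop7HolRatioPerStep (norm_coe_eq_one norm_star_coe_eq_one coe_mul_star_self)
open Summit.QuantumFields.YangMills.Theorems.UnitScaleGibbsBlockPlaquetteStokesLinearisation (norm_rect_sub_one_sub_sum_conj_plaq_le)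
open Summit.QuantumFields.YangMills.Theorems.UnitScaleGibbsBlockPlaquetteStokesLetters (one_add_pow_sub_one_sub_mul_le_sq)
open Summit.QuantumFields.YangMills.Theorems.BlockPlaquetteOneStepLinearisation (norm_plaqHol_avgFun_sub_one_sub_offsetMean_le)

variable {P : Params} {j : ℕ}

section Letters

open scoped Matrix.Norms.L2Operator

variable {n : Type*} [Fintype n] [DecidableEq n]

/-! ## §0 Letters: conjugation vs «subtract `1` and a linear proxy»; conjugation of a transported double sum; the averaged remainder -/

/-- Conjugating a transported double sum: `g·(Σ_t Σ_s T_{t,s} X_{t,s} T_{t,s}*)·g* = Σ_t Σ_s (g T_{t,s}) X_{t,s} (g T_{t,s})*` in `M_N(ℂ)`, `g, T_{t,s} ∈ SU(N)`. [folklore] -/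
theorem conj_sum_sum_conj_eq (g : Matrix.specialUnitaryGroup n ℂ) (T : ℕ → ℕ → Matrix.specialUnitaryGroup n ℂ) (X : ℕ → ℕ → Matrix n n ℂ)
    (A B : Finset ℕ) :
    (g : Matrix n n ℂ) * (∑ t ∈ A, ∑ s ∈ B, ((T t s : Matrix.specialUnitaryGroup n ℂ) : Matrix n n ℂ) * X t s *
        star ((T t s : Matrix.specialUnitaryGroup n ℂ) : Matrix n n ℂ)) * star (g : Matrix n n ℂ) =
      ∑ t ∈ A, ∑ s ∈ B, ((g * T t s : Matrix.specialUnitaryGroup n ℂ) : Matrix n n ℂ) * X t s *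
        star ((g * T t s : Matrix.specialUnitaryGroup n ℂ) : Matrix n n ℂ) := by
  rw [Finset.mul_sum, Finset.sum_mul]
  refine Finset.sum_congr rfl fun t _ => ?_
  rw [Finset.mul_sum, Finset.sum_mul]
  refine Finset.sum_congr rfl fun s _ => ?_
  rw [Submonoid.coe_mul, star_mul]
  noncomm_ring

variable [Nonempty n]

/-- ★ `‖(g Q g⁻¹ − 1) − g Z g*‖ ≤ ‖(Q − 1) − Z‖` for `g, Q ∈ SU(N)` and any matrix `Z`: `g Q g⁻¹ − 1 = g (Q − 1) g*` and unitary conjugation does not increase the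
operator norm. [folklore] -/
theorem norm_coe_conj_sub_one_sub_conj_le (g Q : Matrix.specialUnitaryGroup n ℂ) (Z : Matrix n n ℂ) :
    ‖((g * Q * g⁻¹ : Matrix.specialUnitaryGroup n ℂ) : Matrix n n ℂ) - 1 - (g : Matrix n n ℂ) * Z * star (g : Matrix n n ℂ)‖ ≤
      ‖((Q : Matrix.specialUnitaryGroup n ℂ) : Matrix n n ℂ) - 1 - Z‖ := by
  have e : ((g * Q * g⁻¹ : Matrix.specialUnitaryGroup n ℂ) : Matrix n n ℂ) - 1 - (g : Matrix n n ℂ) * Z * star (g : Matrix n n ℂ) =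
      (g : Matrix n n ℂ) * (((Q : Matrix.specialUnitaryGroup n ℂ) : Matrix n n ℂ) - 1 - Z) * star (g : Matrix n n ℂ) := by
    rw [Submonoid.coe_mul, Submonoid.coe_mul, show ((g⁻¹ : Matrix.specialUnitaryGroup n ℂ) : Matrix n n ℂ) = star (g : Matrix n n ℂ) from rfl,
      mul_sub, mul_sub, sub_mul, sub_mul, mul_one, coe_mul_star_self]
  rw [e]
  calc ‖(g : Matrix n n ℂ) * (((Q : Matrix.specialUnitaryGroup n ℂ) : Matrix n n ℂ) - 1 - Z) * star (g : Matrix n n ℂ)‖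
      ≤ ‖(g : Matrix n n ℂ)‖ * ‖((Q : Matrix.specialUnitaryGroup n ℂ) : Matrix n n ℂ) - 1 - Z‖ * ‖star (g : Matrix n n ℂ)‖ :=
        (norm_mul_le _ _).trans (mul_le_mul_of_nonneg_right (norm_mul_le _ _) (norm_nonneg _))
    _ = ‖((Q : Matrix.specialUnitaryGroup n ℂ) : Matrix n n ℂ) - 1 - Z‖ := by rw [norm_coe_eq_one, norm_star_coe_eq_one]; ring

omit [Nonempty n] in
/-- THE AVERAGED REMAINDER (assembly letter): if `‖V − c•Σ_J tok_J‖ ≤ A` and `‖tok_J − lin_J‖ ≤ B` for every `J`, with `‖c‖·|ι| = 1` (the offset-mean weight), then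
`‖V − c•Σ_J lin_J‖ ≤ A + B`. [folklore] -/
theorem norm_sub_smul_sum_le_of_forall {ι : Type*} [Fintype ι] (V : Matrix n n ℂ) (tok lin : ι → Matrix n n ℂ) (c : ℂ) {A B : ℝ}
    (h1 : ‖V - c • ∑ J, tok J‖ ≤ A) (h2 : ∀ J, ‖tok J - lin J‖ ≤ B) (hc : ‖c‖ * Fintype.card ι = 1) :
    ‖V - c • ∑ J, lin J‖ ≤ A + B := by
  have e : V - c • ∑ J, lin J = (V - c • ∑ J, tok J) + c • ∑ J, (tok J - lin J) := by
    rw [Finset.sum_sub_distrib, smul_sub]; abel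
  rw [e]
  refine (norm_add_le _ _).trans (add_le_add h1 ?_)
  calc ‖c • ∑ J, (tok J - lin J)‖ = ‖c‖ * ‖∑ J, (tok J - lin J)‖ := norm_smul _ _
    _ ≤ ‖c‖ * ∑ J, ‖tok J - lin J‖ := by gcongr; exact norm_sum_le _ _
    _ ≤ ‖c‖ * ∑ _J : ι, B := by gcongr with J; exact h2 J
    _ = B := by rw [Finset.sum_const, Finset.card_univ, nsmul_eq_mul, ← mul_assoc, hc, one_mul]

end Letters

section Main

open scoped Matrix.Norms.L2Operator

variable {n : Type*} [Fintype n] [DecidableEq n] [Nonempty n]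

/-! ## §1 (K): the knit (M1) ⊕ (b′) — one averaging step linearised down to the fine plaquette variables -/

omit [DecidableEq n] [Nonempty n] in
/-- The (0.4) smallness `((d+4)L)²a∕4 ≤ δ_N∕2` forces `L²·a ≤ 1` (`δ_N ≤ 1∕3`, `(d+4)² ≥ 4`). [cite: Balaban1985Averaging, Prop. 1 p.26] -/
theorem sq_mul_le_one_of_smallness {a : ℝ} (ha : 0 ≤ a)
    (hs : ((((P.d + 4) * P.L : ℕ) : ℝ) ^ 2 / 4) * a ≤ deltaSU n / 2) : ((P.L * P.L : ℕ) : ℝ) * a ≤ 1 := by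
  have hδ : deltaSU n ≤ 1 / 3 := min_le_left _ _
  have hL : ((P.L * P.L : ℕ) : ℝ) ≤ (((P.d + 4) * P.L : ℕ) : ℝ) ^ 2 / 4 := by
    push_cast
    have hd : (0 : ℝ) ≤ (P.d : ℝ) := Nat.cast_nonneg _
    have hL0 : (0 : ℝ) ≤ (P.L : ℝ) := Nat.cast_nonneg _
    nlinarith [mul_nonneg hd hL0, mul_nonneg (mul_nonneg hd hd) (mul_nonneg hL0 hL0), mul_nonneg hd (mul_nonneg hL0 hL0)]
  nlinarith [mul_le_mul_of_nonneg_right hL ha]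

/-- The (0.4) index type `J = (r, σ, τ, ρ, ω)` is nonempty (so the offset mean is a genuine average). [folklore] -/
theorem card_index_pos : 0 < Fintype.card ((Fin P.d → Fin P.L) × Equiv.Perm (Fin P.d) × Equiv.Perm (Fin P.d) ×
    Equiv.Perm (Fin P.d) × Equiv.Perm (Fin P.d)) := by
  haveI : Nonempty (Fin P.L) := ⟨⟨0, P.L_pos⟩⟩
  exact Fintype.card_pos

/-- ★★★ **(K) ONE AVERAGING STEP LINEARISED DOWN TO THE FINE PLAQUETTE VARIABLES.**  For the (0.4)+`exp[mean log]` average `Ū = avgFun ℰp U` of a configuration with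
`dist₁(U(∂q)) ≤ a` everywhere and `((d+4)L)²a∕4 ≤ δ_N∕2`: the coarse plaquette variable at `p′ = ⟨y; μ < ν⟩` satisfies
`‖Ū(∂p′) − 1 − |J|⁻¹ Σ_J Σ_{t<L} Σ_{s<L} (T_J T^J_{s,t})·(U(∂p^J_{s,t}) − 1)·(T_J T^J_{s,t})*‖ ≤ 143·s² + (L²a)²`, `s = ((d+4)L)²a∕4`, where `J = (r,σ,τ,ρ,ω)` is the (0.4)
index, `T_J = holAt U (walk (emb y) (stairWord σ (off r)))` the staircase transporter to the corner `x_J = walkEnd (emb y) (stairWord σ (off r))`, `T^J_{s,t} = rowProd U x_J ν t ·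
rowProd U (x_J + t e_ν) μ s`, `p^J_{s,t}` the fine plaquette at `x_J + t e_ν + s e_μ` — (M1) ✓ `norm_plaqHol_avgFun_sub_one_sub_offsetMean_le` composed with (b′)
✓ `norm_rect_sub_one_sub_sum_conj_plaq_le` at every corner `x_J`. [cite: Balaban1985Averaging, (124) p.36 with (9) p.18, (19) p.21] [cite: Balaban1987RG1, (0.3)–(0.4) pp.252–253] -/
theorem norm_plaqHol_avgFun_sub_one_sub_fullLin_le {a : ℝ} (ha : 0 ≤ a) {U : GaugeField P j (Matrix.specialUnitaryGroup n ℂ)}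
    (hU : ∀ q : Plaq P j, dist1 (GaugeField.plaqHol U q) ≤ a)
    (hs : ((((P.d + 4) * P.L : ℕ) : ℝ) ^ 2 / 4) * a ≤ deltaSU n / 2) (y : Site P (j + 1)) {μ ν : Fin P.d} (hμν : μ < ν) :
    ‖(((GaugeField.plaqHol (avgFun (expMeanLogSU (n := n)) U) ⟨y, μ, ν, hμν⟩ : Matrix.specialUnitaryGroup n ℂ) : Matrix n n ℂ) - 1) -
        ((Fintype.card ((Fin P.d → Fin P.L) × Equiv.Perm (Fin P.d) × Equiv.Perm (Fin P.d) × Equiv.Perm (Fin P.d) ×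
          Equiv.Perm (Fin P.d)) : ℂ))⁻¹ • ∑ J : (Fin P.d → Fin P.L) × Equiv.Perm (Fin P.d) × Equiv.Perm (Fin P.d) ×
          Equiv.Perm (Fin P.d) × Equiv.Perm (Fin P.d),
          ∑ t ∈ Finset.range P.L, ∑ s ∈ Finset.range P.L,
            ((holAt U (walk (emb y) (stairWord J.2.1 (off J.1))) *
                (rowProd U (walkEnd (emb y) (stairWord J.2.1 (off J.1))) ν t *
                  rowProd U (shiftN (walkEnd (emb y) (stairWord J.2.1 (off J.1))) ν t) μ s) : Matrix.specialUnitaryGroup n ℂ) : Matrix n n ℂ) *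
              (((GaugeField.plaqHol U ⟨shiftN (shiftN (walkEnd (emb y) (stairWord J.2.1 (off J.1))) ν t) μ s, μ, ν, hμν⟩ :
                Matrix.specialUnitaryGroup n ℂ) : Matrix n n ℂ) - 1) *
              star ((holAt U (walk (emb y) (stairWord J.2.1 (off J.1))) *
                (rowProd U (walkEnd (emb y) (stairWord J.2.1 (off J.1))) ν t *
                  rowProd U (shiftN (walkEnd (emb y) (stairWord J.2.1 (off J.1))) ν t) μ s) : Matrix.specialUnitaryGroup n ℂ) : Matrix n n ℂ)‖ ≤
      143 * (((((P.d + 4) * P.L : ℕ) : ℝ) ^ 2 / 4) * a) ^ 2 + (((P.L * P.L : ℕ) : ℝ) * a) ^ 2 := by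
  have hLa : ((P.L * P.L : ℕ) : ℝ) * a ≤ 1 := sq_mul_le_one_of_smallness (n := n) ha hs
  refine norm_sub_smul_sum_le_of_forall _ _ _ _ (norm_plaqHol_avgFun_sub_one_sub_offsetMean_le ha hU hs y hμν) (fun J => ?_) ?_
  · -- (b′) at the corner `x_J`, conjugated by `T_J`
    have hb := norm_rect_sub_one_sub_sum_conj_plaq_le U (walkEnd (emb y) (stairWord J.2.1 (off J.1))) hμν P.L P.L ha
      (fun t _ s _ => hU _)
    have hb' := (norm_coe_conj_sub_one_sub_conj_le (holAt U (walk (emb y) (stairWord J.2.1 (off J.1)))) _ _).trans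
      (hb.trans (one_add_pow_sub_one_sub_mul_le_sq ha (P.L * P.L) hLa))
    rw [conj_sum_sum_conj_eq] at hb'
    exact hb'
  · rw [norm_inv, Complex.norm_natCast]
    have hc : (0 : ℝ) < Fintype.card ((Fin P.d → Fin P.L) × Equiv.Perm (Fin P.d) × Equiv.Perm (Fin P.d) ×
        Equiv.Perm (Fin P.d) × Equiv.Perm (Fin P.d)) := by exact_mod_cast card_index_pos
    field_simp

/-! ## §2 (S): the substitution step of the `j`-fold induction -/

/-- Transported sums of remainders: if `‖R_{t,s}‖ ≤ ρ` on the tile then `‖Σ_{t<L} Σ_{s<L} T_{t,s} R_{t,s} T_{t,s}*‖ ≤ L²·ρ` (`T_{t,s} ∈ SU(N)`). [folklore] -/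
theorem norm_sum_sum_conj_le (T : ℕ → ℕ → Matrix.specialUnitaryGroup n ℂ) (R : ℕ → ℕ → Matrix n n ℂ) {ρ : ℝ}
    (hR : ∀ t, t < P.L → ∀ s, s < P.L → ‖R t s‖ ≤ ρ) :
    ‖∑ t ∈ Finset.range P.L, ∑ s ∈ Finset.range P.L, ((T t s : Matrix.specialUnitaryGroup n ℂ) : Matrix n n ℂ) * R t s *
        star ((T t s : Matrix.specialUnitaryGroup n ℂ) : Matrix n n ℂ)‖ ≤ ((P.L * P.L : ℕ) : ℝ) * ρ := by
  have hconj : ∀ t s, ‖((T t s : Matrix.specialUnitaryGroup n ℂ) : Matrix n n ℂ) * R t s * star ((T t s : Matrix.specialUnitaryGroup n ℂ) : Matrix n n ℂ)‖ ≤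
      ‖R t s‖ := fun t s =>
    calc ‖((T t s : Matrix.specialUnitaryGroup n ℂ) : Matrix n n ℂ) * R t s * star ((T t s : Matrix.specialUnitaryGroup n ℂ) : Matrix n n ℂ)‖
        ≤ ‖((T t s : Matrix.specialUnitaryGroup n ℂ) : Matrix n n ℂ)‖ * ‖R t s‖ * ‖star ((T t s : Matrix.specialUnitaryGroup n ℂ) : Matrix n n ℂ)‖ :=
          (norm_mul_le _ _).trans (mul_le_mul_of_nonneg_right (norm_mul_le _ _) (norm_nonneg _))
      _ = ‖R t s‖ := by rw [norm_coe_eq_one, norm_star_coe_eq_one]; ring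
  calc ‖∑ t ∈ Finset.range P.L, ∑ s ∈ Finset.range P.L, ((T t s : Matrix.specialUnitaryGroup n ℂ) : Matrix n n ℂ) * R t s *
          star ((T t s : Matrix.specialUnitaryGroup n ℂ) : Matrix n n ℂ)‖
      ≤ ∑ t ∈ Finset.range P.L, ‖∑ s ∈ Finset.range P.L, ((T t s : Matrix.specialUnitaryGroup n ℂ) : Matrix n n ℂ) * R t s *
          star ((T t s : Matrix.specialUnitaryGroup n ℂ) : Matrix n n ℂ)‖ := norm_sum_le _ _
    _ ≤ ∑ t ∈ Finset.range P.L, ∑ s ∈ Finset.range P.L, ‖((T t s : Matrix.specialUnitaryGroup n ℂ) : Matrix n n ℂ) * R t s *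
          star ((T t s : Matrix.specialUnitaryGroup n ℂ) : Matrix n n ℂ)‖ := Finset.sum_le_sum fun t _ => norm_sum_le _ _
    _ ≤ ∑ t ∈ Finset.range P.L, ∑ s ∈ Finset.range P.L, ρ :=
        Finset.sum_le_sum fun t ht => Finset.sum_le_sum fun s hs =>
          (hconj t s).trans (hR t (Finset.mem_range.1 ht) s (Finset.mem_range.1 hs))
    _ = ((P.L * P.L : ℕ) : ℝ) * ρ := by simp [Finset.sum_const, Finset.card_range]; ring

/-- ★★★ **(S) THE SUBSTITUTION STEP — THE INDUCTION ENGINE OF THE `j`-FOLD LINEARISATION.**  Under (K)'s hypotheses, if every fine plaquette deviation carries an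
arbitrary first-order proxy with a uniform remainder, `U(∂q) − 1 = A q + R q`, `‖R q‖ ≤ ρ`, then the coarse plaquette variable is the offset-mean-transported sum of the
PROXIES up to `143·s² + (L²a)² + L²·ρ`: `‖Ū(∂p′) − 1 − |J|⁻¹ Σ_J Σ_{t<L} Σ_{s<L} (T_J T^J_{s,t})·A(p^J_{s,t})·(T_J T^J_{s,t})*‖ ≤ 143·s² + (L²a)² + L²·ρ` — a remainder
born below is carried up with the factor `L²` per level (the `ℓ^∞ → ℓ^∞` norm of the one-step map; iterated, the finest level dominates: S_lin's own window `3j < K`).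
The `j`-fold statement is `j` instantiations with the consumer's index bookkeeping. [cite: Balaban1985Averaging, (124) p.36 with (9) p.18, (19) p.21] [cite: Balaban1987RG1, (0.3)–(0.4) pp.252–253] -/
theorem norm_plaqHol_avgFun_sub_one_sub_fullLin_proxy_le {a ρ : ℝ} (ha : 0 ≤ a) {U : GaugeField P j (Matrix.specialUnitaryGroup n ℂ)}
    (hU : ∀ q : Plaq P j, dist1 (GaugeField.plaqHol U q) ≤ a)
    (hs : ((((P.d + 4) * P.L : ℕ) : ℝ) ^ 2 / 4) * a ≤ deltaSU n / 2)
    (A R : Plaq P j → Matrix n n ℂ)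
    (hAR : ∀ q : Plaq P j, (((GaugeField.plaqHol U q : Matrix.specialUnitaryGroup n ℂ) : Matrix n n ℂ) - 1) = A q + R q)
    (hR : ∀ q : Plaq P j, ‖R q‖ ≤ ρ) (y : Site P (j + 1)) {μ ν : Fin P.d} (hμν : μ < ν) :
    ‖(((GaugeField.plaqHol (avgFun (expMeanLogSU (n := n)) U) ⟨y, μ, ν, hμν⟩ : Matrix.specialUnitaryGroup n ℂ) : Matrix n n ℂ) - 1) -
        ((Fintype.card ((Fin P.d → Fin P.L) × Equiv.Perm (Fin P.d) × Equiv.Perm (Fin P.d) × Equiv.Perm (Fin P.d) ×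
          Equiv.Perm (Fin P.d)) : ℂ))⁻¹ • ∑ J : (Fin P.d → Fin P.L) × Equiv.Perm (Fin P.d) × Equiv.Perm (Fin P.d) ×
          Equiv.Perm (Fin P.d) × Equiv.Perm (Fin P.d),
          ∑ t ∈ Finset.range P.L, ∑ s ∈ Finset.range P.L,
            ((holAt U (walk (emb y) (stairWord J.2.1 (off J.1))) *
                (rowProd U (walkEnd (emb y) (stairWord J.2.1 (off J.1))) ν t *
                  rowProd U (shiftN (walkEnd (emb y) (stairWord J.2.1 (off J.1))) ν t) μ s) : Matrix.specialUnitaryGroup n ℂ) : Matrix n n ℂ) *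
              A ⟨shiftN (shiftN (walkEnd (emb y) (stairWord J.2.1 (off J.1))) ν t) μ s, μ, ν, hμν⟩ *
              star ((holAt U (walk (emb y) (stairWord J.2.1 (off J.1))) *
                (rowProd U (walkEnd (emb y) (stairWord J.2.1 (off J.1))) ν t *
                  rowProd U (shiftN (walkEnd (emb y) (stairWord J.2.1 (off J.1))) ν t) μ s) : Matrix.specialUnitaryGroup n ℂ) : Matrix n n ℂ)‖ ≤
      143 * (((((P.d + 4) * P.L : ℕ) : ℝ) ^ 2 / 4) * a) ^ 2 + (((P.L * P.L : ℕ) : ℝ) * a) ^ 2 + ((P.L * P.L : ℕ) : ℝ) * ρ := by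
  refine norm_sub_smul_sum_le_of_forall _ _ _ _ (norm_plaqHol_avgFun_sub_one_sub_fullLin_le ha hU hs y hμν) (fun J => ?_) ?_
  · -- the difference of the two transported sums is the transported sum of the remainders `R`
    rw [← Finset.sum_sub_distrib]
    simp_rw [← Finset.sum_sub_distrib, ← sub_mul, ← mul_sub, hAR, add_sub_cancel_left]
    exact norm_sum_sum_conj_le _ _ fun t _ s _ => hR _
  · rw [norm_inv, Complex.norm_natCast]
    have hc : (0 : ℝ) < Fintype.card ((Fin P.d → Fin P.L) × Equiv.Perm (Fin P.d) × Equiv.Perm (Fin P.d) ×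
        Equiv.Perm (Fin P.d) × Equiv.Perm (Fin P.d)) := by exact_mod_cast card_index_pos
    field_simp

end Main

end Summit.QuantumFields.YangMills.Theorems.UnitScaleGibbsBlockPlaquetteOneStepFullLinearisation
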